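import Summits.Ventures.PercRepro2.CaseOneRootsAndMark
import Summits.Ventures.PercRepro2.CaseOneRootsOnlyI

/-!
# Gluing faces: a root moves along an edge of weight one
(blind cell PercRepro2, p1 g17; S5 §2.3 «REVISED AT v19» — the face induction of the cell method)

The gadget certificates of S5 (the pairwise cone over the base cells) fail only on MODIFIED-BASE
FACES — Bernstein index `3` in a gadget edge `{x, w}` with `x` a mark (`w` merged into the mark's
cluster) or index `0` (the edge absent, `CaseOneNullDelete`). This file is the identity behind the
index-`3` faces:

* an edge `e` of weight `1` is open on the support (`weight_eq_zero_of_closed_one`), so two events /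
  observables that agree where `e` is open have the same probability / expectation
  (`prob_congr_of_open`, `expect_congr_of_open`);
* along an open edge `{x, y}` the connection events of `x` and of `y` coincide (`conn_swap_left`,
  `conn_swap_right`), hence EVERY case-1 quantity is unchanged when a root is replaced by the other end
  of an edge of weight `1` (`Dpd_glue₂`, `Dpdo_glue₂`, `Dqo_glue₂`, `probQ_glue₂`, `iiExprT_glue₂`,
  `iExprT_glue₂`, `iiExpr_glue₂`, `iExpr_glue₂` and the `₁` twins for the root `a₁`).
The Props, the glued classes and the Bernstein face lemma are in `CaseOneGlued.lean`.
Own code; standard axioms. -/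

set_option linter.unusedSimpArgs false

namespace Summit.Ventures.PercRepro2

namespace CaseOne

/-! ## An edge of weight one is open on the support -/

section Open
variable {E : Type*} [Fintype E] [DecidableEq E] {R : Type*} [CommRing R]

/-- With `p e = 1` the weight vanishes on every configuration where `e` is closed. -/
lemma weight_eq_zero_of_closed_one (p : E → R) {e : E} (he : p e = 1) {ω : Config E}
    (hω : ω e = false) : weight p ω = 0 := by
  rw [weight_eq_mul_edgeFactor p ω e, hω, edgeFactor_false, he, sub_self, mul_zero]

/-- Two observables that agree where an edge of weight `1` is open have the same expectation. -/
lemma expect_congr_of_open (p : E → R) {e : E} (he : p e = 1) {f g : Config E → R}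
    (h : ∀ ω : Config E, ω e = true → f ω = g ω) : expect p f = expect p g := by
  unfold expect
  refine Finset.sum_congr rfl fun ω _ => ?_
  by_cases hω : ω e = true
  · rw [h ω hω]
  · simp only [Bool.not_eq_true] at hω
    rw [weight_eq_zero_of_closed_one p he hω, zero_mul, zero_mul]

/-- Two events that agree where an edge of weight `1` is open have the same probability. -/
lemma prob_congr_of_open (p : E → R) {e : E} (he : p e = 1) {A B : Set (Config E)}
    (h : ∀ ω : Config E, ω e = true → (ω ∈ A ↔ ω ∈ B)) : prob p A = prob p B := by
  unfold prob
  refine Finset.sum_congr rfl fun ω _ => ?_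
  by_cases hω : ω e = true
  · by_cases hA : ω ∈ A
    · rw [Set.indicator_of_mem hA, Set.indicator_of_mem ((h ω hω).1 hA)]
    · rw [Set.indicator_of_notMem hA, Set.indicator_of_notMem (fun hB => hA ((h ω hω).2 hB))]
  · simp only [Bool.not_eq_true] at hω
    by_cases hA : ω ∈ A <;> by_cases hB : ω ∈ B <;>
      simp [hA, hB, weight_eq_zero_of_closed_one p he hω]

end Open

/-! ## Connections along an open edge -/

section Conn
variable {V : Type*} {E : Type*}

/-- The ends of an open edge are joined. -/
lemma conn_of_open {ends : E → Sym2 V} {ω : Config E} {e : E} {x y : V} (hω : ω e = true)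
    (hends : ends e = s(x, y)) : Conn ends ω x y :=
  conn_of_openAdj ⟨e, hω, hends⟩

/-- Along an open edge `{x, y}`: `x ↔ v` iff `y ↔ v`. -/
lemma conn_swap_left {ends : E → Sym2 V} {ω : Config E} {e : E} {x y : V} (hω : ω e = true)
    (hends : ends e = s(x, y)) (v : V) : Conn ends ω x v ↔ Conn ends ω y v :=
  ⟨fun h => conn_trans (conn_symm (conn_of_open hω hends)) h,
    fun h => conn_trans (conn_of_open hω hends) h⟩

/-- Along an open edge `{x, y}`: `v ↔ x` iff `v ↔ y`. -/
lemma conn_swap_right {ends : E → Sym2 V} {ω : Config E} {e : E} {x y : V} (hω : ω e = true)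
    (hends : ends e = s(x, y)) (v : V) : Conn ends ω v x ↔ Conn ends ω v y :=
  ⟨fun h => conn_trans h (conn_of_open hω hends),
    fun h => conn_trans h (conn_symm (conn_of_open hω hends))⟩

end Conn

/-! ## A root moves along an edge of weight one -/

section Glue
variable {V : Type*} {E : Type*} [Fintype E] [DecidableEq E] {R : Type*} [CommRing R]
variable {ends : E → Sym2 V} {e : E} {p : E → R}

/-- `P(Q)` with the root `a₂` moved to `w` along an edge of weight `1`. -/
theorem probQ_glue₂ (he : p e = 1) {a₂ w : V} (hends : ends e = s(a₂, w)) (a₁ : V) :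
    prob p (connEvent ends a₁ a₂)ᶜ = prob p (connEvent ends a₁ w)ᶜ :=
  prob_congr_of_open p he fun ω hω => by
    simp only [Set.mem_compl_iff, mem_connEvent, conn_swap_right hω hends]

/-- `P(Q)` with the root `a₁` moved to `w` along an edge of weight `1`. -/
theorem probQ_glue₁ (he : p e = 1) {a₁ w : V} (hends : ends e = s(a₁, w)) (a₂ : V) :
    prob p (connEvent ends a₁ a₂)ᶜ = prob p (connEvent ends w a₂)ᶜ :=
  prob_congr_of_open p he fun ω hω => by
    simp only [Set.mem_compl_iff, mem_connEvent, conn_swap_left hω hends]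

/-- `D` with the root `a₂` moved to `w`. -/
theorem Dpd_glue₂ (he : p e = 1) {a₂ w : V} (hends : ends e = s(a₂, w)) (a₁ a₃ : V) :
    Dpd p ends a₁ a₂ a₃ = Dpd p ends a₁ w a₃ := by
  unfold Dpd
  exact prob_congr_of_open p he fun ω hω => by
    simp only [Set.mem_inter_iff, Set.mem_compl_iff, mem_connEvent, conn_swap_left hω hends,
      conn_swap_right hω hends]

/-- `D` with the root `a₁` moved to `w`. -/
theorem Dpd_glue₁ (he : p e = 1) {a₁ w : V} (hends : ends e = s(a₁, w)) (a₂ a₃ : V) :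
    Dpd p ends a₁ a₂ a₃ = Dpd p ends w a₂ a₃ := by
  unfold Dpd
  exact prob_congr_of_open p he fun ω hω => by
    simp only [Set.mem_inter_iff, Set.mem_compl_iff, mem_connEvent, conn_swap_left hω hends,
      conn_swap_right hω hends]

/-- `D_o` with the root `a₂` moved to `w`. -/
theorem Dpdo_glue₂ (he : p e = 1) {a₂ w : V} (hends : ends e = s(a₂, w)) (o a₁ a₃ : V) :
    Dpdo p ends o a₁ a₂ a₃ = Dpdo p ends o a₁ w a₃ := by
  unfold Dpdo
  exact prob_congr_of_open p he fun ω hω => by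
    simp only [Set.mem_inter_iff, Set.mem_union, Set.mem_compl_iff, mem_connEvent,
      conn_swap_left hω hends, conn_swap_right hω hends]

/-- `D_o` with the root `a₁` moved to `w`. -/
theorem Dpdo_glue₁ (he : p e = 1) {a₁ w : V} (hends : ends e = s(a₁, w)) (o a₂ a₃ : V) :
    Dpdo p ends o a₁ a₂ a₃ = Dpdo p ends o w a₂ a₃ := by
  unfold Dpdo
  exact prob_congr_of_open p he fun ω hω => by
    simp only [Set.mem_inter_iff, Set.mem_union, Set.mem_compl_iff, mem_connEvent,
      conn_swap_left hω hends, conn_swap_right hω hends]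

/-- `P(Q, o ∈ U)` with the root `a₂` moved to `w`. -/
theorem Dqo_glue₂ (he : p e = 1) {a₂ w : V} (hends : ends e = s(a₂, w)) (o a₁ : V) :
    Dqo p ends o a₁ a₂ = Dqo p ends o a₁ w := by
  unfold Dqo
  exact prob_congr_of_open p he fun ω hω => by
    simp only [Set.mem_inter_iff, Set.mem_union, Set.mem_compl_iff, mem_connEvent,
      conn_swap_left hω hends, conn_swap_right hω hends]

/-- `P(Q, o ∈ U)` with the root `a₁` moved to `w`. -/
theorem Dqo_glue₁ (he : p e = 1) {a₁ w : V} (hends : ends e = s(a₁, w)) (o a₂ : V) :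
    Dqo p ends o a₁ a₂ = Dqo p ends o w a₂ := by
  unfold Dqo
  exact prob_congr_of_open p he fun ω hω => by
    simp only [Set.mem_inter_iff, Set.mem_union, Set.mem_compl_iff, mem_connEvent,
      conn_swap_left hω hends, conn_swap_right hω hends]

/-- `iiExprT` with the root `a₂` moved to `w` (any threshold pair). -/
theorem iiExprT_glue₂ (he : p e = 1) {a₂ w : V} (hends : ends e = s(a₂, w)) (o a₁ a₃ b : V)
    (c₀ c₁ : R) : iiExprT p ends o a₁ a₂ a₃ b c₀ c₁ = iiExprT p ends o a₁ w a₃ b c₀ c₁ := by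
  rw [iiExprT_eq, iiExprT_eq]
  have hQ := probQ_glue₂ he hends a₁
  have h1 : prob p (connEvent ends a₂ b ∩ connEvent ends a₁ a₃ ∩ connEvent ends a₂ o ∩
      (connEvent ends a₁ a₂)ᶜ) = prob p (connEvent ends w b ∩ connEvent ends a₁ a₃ ∩
      connEvent ends w o ∩ (connEvent ends a₁ w)ᶜ) :=
    prob_congr_of_open p he fun ω hω => by
      simp only [Set.mem_inter_iff, Set.mem_compl_iff, mem_connEvent, conn_swap_left hω hends,
        conn_swap_right hω hends]
  have h2 : prob p (connEvent ends a₂ b ∩ (connEvent ends a₁ a₂)ᶜ) =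
      prob p (connEvent ends w b ∩ (connEvent ends a₁ w)ᶜ) :=
    prob_congr_of_open p he fun ω hω => by
      simp only [Set.mem_inter_iff, Set.mem_compl_iff, mem_connEvent, conn_swap_left hω hends,
        conn_swap_right hω hends]
  have h3 : prob p (connEvent ends a₁ a₃ ∩ connEvent ends a₂ o ∩ (connEvent ends a₁ a₂)ᶜ) =
      prob p (connEvent ends a₁ a₃ ∩ connEvent ends w o ∩ (connEvent ends a₁ w)ᶜ) :=
    prob_congr_of_open p he fun ω hω => by
      simp only [Set.mem_inter_iff, Set.mem_compl_iff, mem_connEvent, conn_swap_left hω hends,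
        conn_swap_right hω hends]
  have h4 : prob p (connEvent ends a₂ b ∩ connEvent ends a₁ a₃ ∩ (connEvent ends a₁ a₂)ᶜ) =
      prob p (connEvent ends w b ∩ connEvent ends a₁ a₃ ∩ (connEvent ends a₁ w)ᶜ) :=
    prob_congr_of_open p he fun ω hω => by
      simp only [Set.mem_inter_iff, Set.mem_compl_iff, mem_connEvent, conn_swap_left hω hends,
        conn_swap_right hω hends]
  have h5 : prob p (connEvent ends a₁ a₃ ∩ (connEvent ends a₁ a₂)ᶜ) =
      prob p (connEvent ends a₁ a₃ ∩ (connEvent ends a₁ w)ᶜ) :=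
    prob_congr_of_open p he fun ω hω => by
      simp only [Set.mem_inter_iff, Set.mem_compl_iff, mem_connEvent, conn_swap_left hω hends,
        conn_swap_right hω hends]
  rw [hQ, h1, h2, h3, h4, h5]

/-- `iiExprT` with the root `a₁` moved to `w` (any threshold pair). -/
theorem iiExprT_glue₁ (he : p e = 1) {a₁ w : V} (hends : ends e = s(a₁, w)) (o a₂ a₃ b : V)
    (c₀ c₁ : R) : iiExprT p ends o a₁ a₂ a₃ b c₀ c₁ = iiExprT p ends o w a₂ a₃ b c₀ c₁ := by
  rw [iiExprT_eq, iiExprT_eq]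
  have hQ := probQ_glue₁ he hends a₂
  have h1 : prob p (connEvent ends a₂ b ∩ connEvent ends a₁ a₃ ∩ connEvent ends a₂ o ∩
      (connEvent ends a₁ a₂)ᶜ) = prob p (connEvent ends a₂ b ∩ connEvent ends w a₃ ∩
      connEvent ends a₂ o ∩ (connEvent ends w a₂)ᶜ) :=
    prob_congr_of_open p he fun ω hω => by
      simp only [Set.mem_inter_iff, Set.mem_compl_iff, mem_connEvent, conn_swap_left hω hends,
        conn_swap_right hω hends]
  have h2 : prob p (connEvent ends a₂ b ∩ (connEvent ends a₁ a₂)ᶜ) =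
      prob p (connEvent ends a₂ b ∩ (connEvent ends w a₂)ᶜ) :=
    prob_congr_of_open p he fun ω hω => by
      simp only [Set.mem_inter_iff, Set.mem_compl_iff, mem_connEvent, conn_swap_left hω hends,
        conn_swap_right hω hends]
  have h3 : prob p (connEvent ends a₁ a₃ ∩ connEvent ends a₂ o ∩ (connEvent ends a₁ a₂)ᶜ) =
      prob p (connEvent ends w a₃ ∩ connEvent ends a₂ o ∩ (connEvent ends w a₂)ᶜ) :=
    prob_congr_of_open p he fun ω hω => by
      simp only [Set.mem_inter_iff, Set.mem_compl_iff, mem_connEvent, conn_swap_left hω hends,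
        conn_swap_right hω hends]
  have h4 : prob p (connEvent ends a₂ b ∩ connEvent ends a₁ a₃ ∩ (connEvent ends a₁ a₂)ᶜ) =
      prob p (connEvent ends a₂ b ∩ connEvent ends w a₃ ∩ (connEvent ends w a₂)ᶜ) :=
    prob_congr_of_open p he fun ω hω => by
      simp only [Set.mem_inter_iff, Set.mem_compl_iff, mem_connEvent, conn_swap_left hω hends,
        conn_swap_right hω hends]
  have h5 : prob p (connEvent ends a₁ a₃ ∩ (connEvent ends a₁ a₂)ᶜ) =
      prob p (connEvent ends w a₃ ∩ (connEvent ends w a₂)ᶜ) :=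
    prob_congr_of_open p he fun ω hω => by
      simp only [Set.mem_inter_iff, Set.mem_compl_iff, mem_connEvent, conn_swap_left hω hends,
        conn_swap_right hω hends]
  rw [hQ, h1, h2, h3, h4, h5]

/-- `iExprT` with the root `a₂` moved to `w` (any threshold pair). -/
theorem iExprT_glue₂ (he : p e = 1) {a₂ w : V} (hends : ends e = s(a₂, w)) (o a₁ a₃ b : V)
    (c₀ c₁ : R) : iExprT p ends o a₁ a₂ a₃ b c₀ c₁ = iExprT p ends o a₁ w a₃ b c₀ c₁ := by
  rw [iExprT_eq, iExprT_eq]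
  have hQ := probQ_glue₂ he hends a₁
  have h1 : prob p (connEvent ends a₁ b ∩ connEvent ends a₁ a₃ ∩ connEvent ends a₂ o ∩
      (connEvent ends a₁ a₂)ᶜ) = prob p (connEvent ends a₁ b ∩ connEvent ends a₁ a₃ ∩
      connEvent ends w o ∩ (connEvent ends a₁ w)ᶜ) :=
    prob_congr_of_open p he fun ω hω => by
      simp only [Set.mem_inter_iff, Set.mem_compl_iff, mem_connEvent, conn_swap_left hω hends,
        conn_swap_right hω hends]
  have h2 : prob p (connEvent ends a₁ b ∩ (connEvent ends a₁ a₂)ᶜ) =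
      prob p (connEvent ends a₁ b ∩ (connEvent ends a₁ w)ᶜ) :=
    prob_congr_of_open p he fun ω hω => by
      simp only [Set.mem_inter_iff, Set.mem_compl_iff, mem_connEvent, conn_swap_left hω hends,
        conn_swap_right hω hends]
  have h3 : prob p (connEvent ends a₁ a₃ ∩ connEvent ends a₂ o ∩ (connEvent ends a₁ a₂)ᶜ) =
      prob p (connEvent ends a₁ a₃ ∩ connEvent ends w o ∩ (connEvent ends a₁ w)ᶜ) :=
    prob_congr_of_open p he fun ω hω => by
      simp only [Set.mem_inter_iff, Set.mem_compl_iff, mem_connEvent, conn_swap_left hω hends,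
        conn_swap_right hω hends]
  have h4 : prob p (connEvent ends a₁ b ∩ connEvent ends a₁ a₃ ∩ (connEvent ends a₁ a₂)ᶜ) =
      prob p (connEvent ends a₁ b ∩ connEvent ends a₁ a₃ ∩ (connEvent ends a₁ w)ᶜ) :=
    prob_congr_of_open p he fun ω hω => by
      simp only [Set.mem_inter_iff, Set.mem_compl_iff, mem_connEvent, conn_swap_left hω hends,
        conn_swap_right hω hends]
  have h5 : prob p (connEvent ends a₁ a₃ ∩ (connEvent ends a₁ a₂)ᶜ) =
      prob p (connEvent ends a₁ a₃ ∩ (connEvent ends a₁ w)ᶜ) :=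
    prob_congr_of_open p he fun ω hω => by
      simp only [Set.mem_inter_iff, Set.mem_compl_iff, mem_connEvent, conn_swap_left hω hends,
        conn_swap_right hω hends]
  rw [hQ, h1, h2, h3, h4, h5]

/-- `iExprT` with the root `a₁` moved to `w` (any threshold pair). -/
theorem iExprT_glue₁ (he : p e = 1) {a₁ w : V} (hends : ends e = s(a₁, w)) (o a₂ a₃ b : V)
    (c₀ c₁ : R) : iExprT p ends o a₁ a₂ a₃ b c₀ c₁ = iExprT p ends o w a₂ a₃ b c₀ c₁ := by
  rw [iExprT_eq, iExprT_eq]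
  have hQ := probQ_glue₁ he hends a₂
  have h1 : prob p (connEvent ends a₁ b ∩ connEvent ends a₁ a₃ ∩ connEvent ends a₂ o ∩
      (connEvent ends a₁ a₂)ᶜ) = prob p (connEvent ends w b ∩ connEvent ends w a₃ ∩
      connEvent ends a₂ o ∩ (connEvent ends w a₂)ᶜ) :=
    prob_congr_of_open p he fun ω hω => by
      simp only [Set.mem_inter_iff, Set.mem_compl_iff, mem_connEvent, conn_swap_left hω hends,
        conn_swap_right hω hends]
  have h2 : prob p (connEvent ends a₁ b ∩ (connEvent ends a₁ a₂)ᶜ) =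
      prob p (connEvent ends w b ∩ (connEvent ends w a₂)ᶜ) :=
    prob_congr_of_open p he fun ω hω => by
      simp only [Set.mem_inter_iff, Set.mem_compl_iff, mem_connEvent, conn_swap_left hω hends,
        conn_swap_right hω hends]
  have h3 : prob p (connEvent ends a₁ a₃ ∩ connEvent ends a₂ o ∩ (connEvent ends a₁ a₂)ᶜ) =
      prob p (connEvent ends w a₃ ∩ connEvent ends a₂ o ∩ (connEvent ends w a₂)ᶜ) :=
    prob_congr_of_open p he fun ω hω => by
      simp only [Set.mem_inter_iff, Set.mem_compl_iff, mem_connEvent, conn_swap_left hω hends,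
        conn_swap_right hω hends]
  have h4 : prob p (connEvent ends a₁ b ∩ connEvent ends a₁ a₃ ∩ (connEvent ends a₁ a₂)ᶜ) =
      prob p (connEvent ends w b ∩ connEvent ends w a₃ ∩ (connEvent ends w a₂)ᶜ) :=
    prob_congr_of_open p he fun ω hω => by
      simp only [Set.mem_inter_iff, Set.mem_compl_iff, mem_connEvent, conn_swap_left hω hends,
        conn_swap_right hω hends]
  have h5 : prob p (connEvent ends a₁ a₃ ∩ (connEvent ends a₁ a₂)ᶜ) =
      prob p (connEvent ends w a₃ ∩ (connEvent ends w a₂)ᶜ) :=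
    prob_congr_of_open p he fun ω hω => by
      simp only [Set.mem_inter_iff, Set.mem_compl_iff, mem_connEvent, conn_swap_left hω hends,
        conn_swap_right hω hends]
  rw [hQ, h1, h2, h3, h4, h5]

/-- `iiExpr` with the root `a₂` moved to `w`. -/
theorem iiExpr_glue₂ (he : p e = 1) {a₂ w : V} (hends : ends e = s(a₂, w)) (o a₁ a₃ b : V) :
    iiExpr p ends o a₁ a₂ a₃ b = iiExpr p ends o a₁ w a₃ b := by
  rw [iiExpr_eq_iiExprT, iiExpr_eq_iiExprT, Dpdo_glue₂ he hends, Dpd_glue₂ he hends,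
    iiExprT_glue₂ he hends]

/-- `iiExpr` with the root `a₁` moved to `w`. -/
theorem iiExpr_glue₁ (he : p e = 1) {a₁ w : V} (hends : ends e = s(a₁, w)) (o a₂ a₃ b : V) :
    iiExpr p ends o a₁ a₂ a₃ b = iiExpr p ends o w a₂ a₃ b := by
  rw [iiExpr_eq_iiExprT, iiExpr_eq_iiExprT, Dpdo_glue₁ he hends, Dpd_glue₁ he hends,
    iiExprT_glue₁ he hends]

/-- `iExpr` with the root `a₂` moved to `w`. -/
theorem iExpr_glue₂ (he : p e = 1) {a₂ w : V} (hends : ends e = s(a₂, w)) (o a₁ a₃ b : V) :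
    iExpr p ends o a₁ a₂ a₃ b = iExpr p ends o a₁ w a₃ b := by
  rw [iExpr_eq_iExprT, iExpr_eq_iExprT, Dpdo_glue₂ he hends, Dpd_glue₂ he hends,
    iExprT_glue₂ he hends]

/-- `iExpr` with the root `a₁` moved to `w`. -/
theorem iExpr_glue₁ (he : p e = 1) {a₁ w : V} (hends : ends e = s(a₁, w)) (o a₂ a₃ b : V) :
    iExpr p ends o a₁ a₂ a₃ b = iExpr p ends o w a₂ a₃ b := by
  rw [iExpr_eq_iExprT, iExpr_eq_iExprT, Dpdo_glue₁ he hends, Dpd_glue₁ he hends,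
    iExprT_glue₁ he hends]

end Glue

end CaseOne

end Summit.Ventures.PercRepro2
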